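import Summits.BirchSwinnertonDyer.BirchSwinnertonDyer.Theorems.KolyvaginRankRigidityAtTwoClassesIntoSelmerBadDefect
import HarnessLib

/-!
# Route `KolyvaginRankRigidityAtTwo`, crux V2♭ (stmt-BirchSwinnertonDyer-24623), sub-rung (i-b), BAD half,
# concrete data: `n′ • c_M(m) ∈ Sel_v` at every finite `v ∤ m` for the tree's Kolyvagin–Heegner data at
# ZHANG–Kolyvagin levels, any prime `p`, modulo [GZ86 III (3.1)] — NO coprimality `(n′, p) = 1`

Sequel of `…ClassesIntoSelmerBadDefect` (the abstract bounded-defect END); width prover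
`bsd-line-krr2-p2` (g5), LEAD re-tasking 05:52Z; `--supports stmt-BirchSwinnertonDyer-24623 --as helper`.
THEOREMS ONLY; BSD is not proved by any of this. The theorem below is JET's
`hloc_concrete_of_GZ31_zhang` (Theorems/Rank1ResidualJetKolyvaginClassLocal) with its binder
`hcop : IsCoprime p^M n′` REMOVED and the conclusion weakened to the `n′`-multiple — the form that survives
at `p = 2` when a Tamagawa number (or `#E(ℚ)_tors`) is even; the proof is JET's verbatim (level data of
x11b3's `KolyvaginH44.exists_levelData`, Zhang re-typings of `KolyCert`, (β2) trace relation, (3.3)), its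
last line going through `zsmul_kolyvaginClass_kolyvaginPoint_mem_selmerLocalKer_of_GZ31_E0`.

References (locators only): [cite: GrossLMS1991, §6 Prop. 6.2 (1) and proof (pp. 244–245), Prop. 3.7 (1),
§3 (3.3), §4 (4.1), Lemma 4.3] [cite: McCallumLMS1991, Lemma 4.3, §4 (4)–(6)] [cite: GrossZagier1986, III (3.1)]
[cite: MilneADT2006, Ch. I Prop. 3.8] [cite: WZhang2014, Notations (xii)].
-/

set_option autoImplicit false
-- the Theorems namespace of this sub repeats the summit name by design (D-0017 nested layout)
set_option linter.dupNamespace false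

noncomputable section

open scoped Classical
open scoped AddSubgroup

namespace Summit.BirchSwinnertonDyer.BirchSwinnertonDyer.Theorems.KolyvaginRankRigidity

open WeierstrassCurve NumberField IsDedekindDomain Field Finset
  Literature.NumberTheory.EllipticCurves Literature.NumberTheory.GaloisRepresentations
  Literature.NumberTheory.EllipticCurves.KolyvaginCocycle
  Literature.NumberTheory.EllipticCurves.KolyvaginEuler
  Literature.NumberTheory.EllipticCurves.RingClassField
  Literature.NumberTheory.EllipticCurves.ModularForms
  Summit.BirchSwinnertonDyer.Rank1Residual.X11b Summit.BirchSwinnertonDyer.Rank1Residual.X11b.Three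
  Summit.BirchSwinnertonDyer.Rank1Residual.X11b.Three.GrossBadPlace
  Summit.BirchSwinnertonDyer.Rank1Residual.X11b.KolyvaginHloc

/-! ## §3 The concrete classes at Zhang–Kolyvagin levels: `n′ • c_M(m) ∈ Sel_v` at every finite `v ∤ m` -/

section Concrete

-- `K : Type`: the tree's ring-class class field theory is universe `0`.
variable {K : Type} [Field K] [NumberField K] {N : ℕ} {W : WeierstrassCurve ℚ}

/-- **Gross 1991 Prop. 6.2 (1) for the CONCRETE classes at ZHANG–Kolyvagin levels, BOUNDED-DEFECT
form (any prime `p`, so `p = 2` included).** For `K` imaginary quadratic with `(N, d_K) = 1` and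
`d_K < −4`, a frame `(Dt, β, ι)` at level `N`, a square-free product `n` of Zhang–Kolyvagin primes of
index `≥ M`, concrete Kolyvagin–Heegner data `d m` at every `m ∣ n`, an integer `n′`, the labelled input
`hGZ` ([GZ86 III (3.1)] in the receptacle form of Gross p. 245: at every place of BAD reduction the
`n′`-multiples of the local images of the `𝒢_m`-conjugates of `y(m)` and of `y(m/ℓ)↑` lie in
`E⁰(K̄_v)`; cite-only) and the admissibility `hA` of every `E(K[m]) ⊆ E(K̄)` for `p^M` (Gross Lemma 4.3;
at `p = 2` on the route's habitat: `KolyvaginRankRigidity.isAdmissible_pointsSubgroup_two`): at every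
`m ∣ n` and every finite place `v ∤ m`, **`n′ • c_M(m) ∈ selmerLocalKer (E/K) K_v p^M`**. This is JET's
`hloc_concrete_of_GZ31_zhang` with its binder `hcop : IsCoprime p^M n′` REMOVED (proof verbatim, last
line through `zsmul_kolyvaginClass_kolyvaginPoint_mem_selmerLocalKer_of_GZ31_E0`); with `hcop` one
divides `n′` out and recovers JET's statement. At a good `v` the factor `n′` is superfluous
(`ClassesIntoSelmerGood`). [cite: GrossLMS1991, §6 Prop. 6.2 (1) and proof, Prop. 3.7 (1), §3 (3.3),
§4 (4.1), Lemma 4.3] [cite: McCallumLMS1991, Lemma 4.3, §4 (4)–(6)] [cite: GrossZagier1986, III (3.1)]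
[cite: MilneADT2006, Ch. I Prop. 3.8] [cite: WZhang2014, Notations (xii)] -/
theorem zsmul_kolyvaginClass_mem_selmerLocalKer_of_GZ31_zhang [NeZero N] [W.IsElliptic] [W.IsGloballyMinimal]
    (hK : IsImaginaryQuadratic K) (ι : K →+* ℂ)
    {p M : ℕ} (hp : p.Prime)
    (Dt : ModularParametrizationData W N) {β : ℤ}
    (hND : IsCoprime (N : ℤ) (NumberField.discr K)) (hD : NumberField.discr K < -4)
    {n : ℕ} (hn : Squarefree n)
    (hkol : ∀ q ∈ n.primeFactors,
      Zhang2014.IsKolyvaginPrime N W K p q ∧ M ≤ Zhang2014.kolyvaginIndex W p q)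
    (d : (m : ℕ) → m ∣ n → KolyvaginHeegnerData Dt β ι m)
    {n' : ℤ}
    (hGZ : ∀ (m : ℕ) (hm : m ∣ n) (γ : ringClassField K ι m ≃ₐ[ℚ] ringClassField K ι m),
      γ ∈ ringClassGal ι m → ∀ v : HeightOneSpectrum (𝓞 K), ¬ (W.baseChange K).HasGoodReductionAt v →
        n' • pointsMap (W.baseChange K) (v.adicCompletion K)
            ((d m hm).toGeomPoints (pointGalHom W (ringClassField K ι m) γ (d m hm).y)) ∈
          E0Receptacle (W.baseChange K) v ∧
        ∀ (ℓ : ℕ) (hℓ : ℓ ∈ m.primeFactors)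
          (hle : ringClassField K ι (m / ℓ) ≤ ringClassField K ι m),
          n' • pointsMap (W.baseChange K) (v.adicCompletion K)
              ((d m hm).toGeomPoints (pointGalHom W (ringClassField K ι m) γ
                (WeierstrassCurve.Affine.Point.map (W' := W)
                  ((RingClassField.inclusion ι hle).restrictScalars ℚ)
                  (d (m / ℓ) ((Nat.div_dvd_of_dvd (Nat.dvd_of_mem_primeFactors hℓ)).trans hm)).y))) ∈
            E0Receptacle (W.baseChange K) v)
    (hA : ∀ (m : ℕ) (hm : m ∣ n),
      IsAdmissible (absoluteGaloisGroup K) (d m hm).pointsSubgroup ((p ^ M : ℕ) : ℤ)) :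
    ∀ (m : ℕ) (hm : m ∣ n) (v : HeightOneSpectrum (𝓞 K)), (m : 𝓞 K) ∉ v.asIdeal →
      n' • (d m hm).kolyvaginClass hp M ∈
        selmerLocalKer (W.baseChange K) (v.adicCompletion K) ((p ^ M : ℕ) : ℤ) := by
  intro m hm v hmv
  haveI : Fact p.Prime := ⟨hp⟩
  have hn0 : n ≠ 0 := Squarefree.ne_zero hn
  have hm0 : m ≠ 0 := ne_zero_of_dvd_ne_zero hn0 hm
  have hinert : ∀ q ∈ n.primeFactors, (Ideal.span {(q : 𝓞 K)}).IsPrime :=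
    fun q hq ↦ (hkol q hq).1.2.2.2.2.1
  have hdiv : ∀ Q : geomPoints (W.baseChange K), ∃ R, ((p ^ M : ℕ) : ℤ) • R = Q :=
    (W.baseChange K).zsmul_geomPoints_surjective_of_charZero
      (by exact_mod_cast pow_ne_zero M hp.ne_zero)
  -- THE SEAM: level data at every level (x11b3-p2 GEN 7, `exists_levelData`)
  choose σ H f y π j e hord hj hπρ hfsec hHρ hdict hjunk using
    fun k ↦ KolyvaginH44.exists_levelData (W := W) (Dt := Dt) (β := β) hK ι hn hinert d k
  -- `𝒢_m = ringClassGal ι m`, a finite commutative group acting on `E(K[m])` through `pointGalHom`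
  letI hcg : ∀ k, CommGroup (ringClassGal ι k) := fun k ↦
    { (inferInstance : Group (ringClassGal ι k)) with
      mul_comm := fun a b ↦ (KolyvaginH44.isMulCommutative_ringClassGal' hK ι k).is_comm.comm a b }
  haveI hfin : ∀ k, Finite (ringClassGal ι k) := KolyvaginH44.finite_ringClassGal hK ι
  letI act : ∀ k, DistribMulAction (ringClassGal ι k)
      ((W.baseChange (ringClassField K ι k)).toAffine.Point) := fun k ↦
    DistribMulAction.compHom _ ((pointGalHom W (ringClassField K ι k)).comp (ringClassGal ι k).subtype)
  letI hft : ∀ k, Fintype (ringClassGal ι k ⧸ H k) := fun k ↦ Fintype.ofFinite _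
  have hsmul : ∀ (k) (g : ringClassGal ι k) (Q : (W.baseChange (ringClassField K ι k)).toAffine.Point),
      g • Q = pointGalHom W (ringClassField K ι k)
        (g : ringClassField K ι k ≃ₐ[ℚ] ringClassField K ι k) Q := fun _ _ _ ↦ rfl
  -- the inclusion `ρ_m : 𝒢_m ≤ Aut_ℚ(K[m])` (the identity `iA_m` is `AddEquiv.refl`)
  set ρ : ∀ k, ringClassGal ι k →* (ringClassField K ι k ≃ₐ[ℚ] ringClassField K ι k) :=
    fun k ↦ (ringClassGal ι k).subtype with hρdef
  have hρ : ∀ k, Function.Injective (ρ k) := fun k ↦ (ringClassGal ι k).subtype_injective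
  have hj' : ∀ (k) (g : absoluteGaloisGroup K)
      (a : (W.baseChange (ringClassField K ι k)).toAffine.Point),
      j k (π k g • a) = g • j k a := fun k g a ↦ by rw [hsmul]; exact hj k g a
  have hπρ' : ∀ (k) (τ : absoluteGaloisGroup K) (x : ringClassField K ι k),
      τ • e k x = e k (ρ k (π k τ) x) := fun k τ x ↦ hπρ k τ x
  -- the abstract Kolyvagin point IS `P(m)` at the divisors (x11b3-p8's G1)
  have hP : ∀ (k) (hk : k ∣ n),
      j k (kolyvaginPoint (σ k) k.primeFactors (f k) (y k)) =
        (d k hk).toGeomPoints (d k hk).derivedPoint := by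
    intro k hk
    obtain ⟨hjk, hyk, hσk, hfS⟩ := hdict k hk
    rw [hjk, hyk]
    congr 1
    have hbij := KolyvaginH37Bridge.bijOn_of_section_of_transversal (ρ k) (hρ k)
      (H := H k) (Γ := ringClassGal ι k) (G₁ := ringClassGalOver ι k 1) (hHρ k)
      (S := ((d k hk).S : Set _)) (fun s hs ↦ (d k hk).S_subset s hs)
      (fun s hs ↦ ⟨⟨s, (d k hk).S_subset s hs⟩, rfl⟩) (d k hk).S_transversal (f k) (hfsec k) hfS
    exact KolyvaginH37Bridge.map_kolyvaginPoint_eq_derivedPoint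
      (pointGalHom W (ringClassField K ι k)) (ρ k) (AddMonoidHom.id _) (fun g a ↦ hsmul k g a)
      (hn.squarefree_of_dvd hk) hσk (f k) hbij (d k hk).y
  -- the dictionary clauses the abstract ENDs read
  have hyA : ∀ (k : ℕ) (hk : k ∣ n), AddEquiv.refl _ (y k) = (d k hk).y :=
    fun k hk ↦ (hdict k hk).2.1
  have hσA : ∀ (k : ℕ) (hk : k ∣ n), ∀ q ∈ k.primeFactors, ρ k (σ k q) = (d k hk).σ q :=
    fun k hk ↦ (hdict k hk).2.2.1
  -- `hA`, `hPt` (P4-A), `hgen`, `hdvd`, `hI` (P4-B) at level `m`, in ABSTRACT currency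
  have hA' : IsAdmissible (absoluteGaloisGroup K) (j m).range ((p ^ M : ℕ) : ℤ) := by
    rw [(hdict m hm).1]; exact hA m hm
  have hPt' : j m (kolyvaginPoint (σ m) m.primeFactors (f m) (y m)) ∈
      invPoints (absoluteGaloisGroup K) (j m).range ((p ^ M : ℕ) : ℤ) :=
    KolyCert.kolyvaginPoint_mem_invPoints_of_dvd_zhang hK ι Dt hp hND hD hn hkol d σ
      (fun k ↦ k.primeFactors) H f y π j hj' ρ hρ (fun _ ↦ AddEquiv.refl _)
      (fun k _ g a ↦ hsmul k g a) hyA hσA (fun _ _ ↦ rfl) (fun k _ ↦ hfsec k) (fun k _ ↦ hHρ k)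
      m hm
  have hgen : H m ≤ Subgroup.closure (σ m '' (m.primeFactors : Set ℕ)) :=
    KolyvaginH44.le_closure_of_dvd hK ι Dt hn d σ (fun k ↦ k.primeFactors) H ρ hρ hσA
      (fun _ _ ↦ rfl) (fun k _ ↦ hHρ k) m hm
  have hdvd : ∀ ℓ ∈ m.primeFactors, ((p ^ M : ℕ) : ℤ) ∣ ((ℓ + 1 : ℕ) : ℤ) := by
    intro ℓ hℓ
    obtain ⟨-, hℓM⟩ := hkol ℓ (Nat.primeFactors_mono hm hn0 hℓ)
    exact Int.natCast_dvd_natCast.mpr (Zhang2014.le_kolyvaginIndex_iff.mp hℓM).1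
  obtain ⟨𝔐, h𝔐⟩ := v.localPrimesAbove_nonempty
  have hI' : ∀ t ∈ 𝔐.inertia (absoluteGaloisGroup (v.adicCompletion K)),
      resGal (K := K) (v.adicCompletion K) t • j m (kolyvaginPoint (σ m) m.primeFactors (f m) (y m)) =
        j m (kolyvaginPoint (σ m) m.primeFactors (f m) (y m)) :=
    KolyvaginH44.smul_kolyvaginPoint_eq_of_mem_localInertia (W := W) hK ι σ
      (fun k ↦ k.primeFactors) H f y π j hj' e ρ hρ hπρ' m v hmv 𝔐 h𝔐
  -- the abstract class IS the concrete class `c_M(m)`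
  have hPt : (d m hm).toGeomPoints (d m hm).derivedPoint ∈
      invPoints (absoluteGaloisGroup K) (d m hm).pointsSubgroup ((p ^ M : ℕ) : ℤ) := by
    have h := hPt'
    rw [hP m hm, (hdict m hm).1] at h
    exact h
  have hc : (d m hm).kolyvaginClass hp M =
      kolyvaginClass (W.baseChange K) ((p ^ M : ℕ) : ℤ) hdiv hA'
        (j m (kolyvaginPoint (σ m) m.primeFactors (f m) (y m))) hPt' := by
    rw [KolyvaginHeegnerData.kolyvaginClass_of_admissible _ hp M (hA m hm) hPt]
    exact KolyvaginH44.kolyvaginClass_congr (by rw [(hdict m hm).1]; rfl) (hP m hm).symm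
  rw [hc]
  -- Gross Prop. 6.2 (1) by the reduction type of `E/K` at `v`
  by_cases hgood : (W.baseChange K).HasGoodReductionAt v
  · -- good `v`: Milne *ADT* I.3.8 for `E` itself (x11b3-p1's leaf), no receptacle clause; the class
    -- itself is Selmer, a fortiori its multiple
    exact AddSubgroup.zsmul_mem _
      (kolyvaginClass_mem_selmerLocalKer_of_inertia_of_hasGoodReductionAt (W.baseChange K) hA'
        hPt' v hgood h𝔐 hI') n'
  -- bad `v`: the `E⁰(K̄_v)`-receptacle END
  have hm' : ∀ {ℓ : ℕ}, ℓ ∈ m.primeFactors → m / ℓ ∣ n := fun hℓ ↦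
    (Nat.div_dvd_of_dvd (Nat.dvd_of_mem_primeFactors hℓ)).trans hm
  have hle : ∀ {ℓ : ℕ}, ℓ ∈ m.primeFactors → ringClassField K ι (m / ℓ) ≤ ringClassField K ι m :=
    fun hℓ ↦ ringClassField_mono hK ι (Nat.div_dvd_of_dvd (Nat.dvd_of_mem_primeFactors hℓ)) hm0
  -- `E′_m`: generated by the `𝒢_m`-orbits of `y(m)` and of the `y(m/ℓ)↑` read in `E(K[m])`
  set S : Set ((W.baseChange (ringClassField K ι m)).toAffine.Point) :=
    {x | ∃ γ : ringClassGal ι m, x = γ • (d m hm).y ∨ ∃ (ℓ : ℕ) (hℓ : ℓ ∈ m.primeFactors),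
      x = γ • WeierstrassCurve.Affine.Point.map (W' := W)
        ((RingClassField.inclusion ι (hle hℓ)).restrictScalars ℚ) (d (m / ℓ) (hm' hℓ)).y}
    with hSdef
  have hSstab : ∀ (g : ringClassGal ι m), ∀ s ∈ S, g • s ∈ S := by
    rintro g s ⟨γ, h | ⟨ℓ, hℓ, h⟩⟩
    · refine ⟨g * γ, Or.inl ?_⟩
      rw [h]; exact (mul_smul g γ _).symm
    · refine ⟨g * γ, Or.inr ⟨ℓ, hℓ, ?_⟩⟩
      rw [h]; exact (mul_smul g γ _).symm
  have hyS : y m ∈ S := by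
    rw [(hdict m hm).2.1]; exact ⟨1, Or.inl (one_smul _ _).symm⟩
  have hzS : ∀ (ℓ : ℕ) (hℓ : ℓ ∈ m.primeFactors),
      WeierstrassCurve.Affine.Point.map (W' := W)
        ((RingClassField.inclusion ι (hle hℓ)).restrictScalars ℚ) (d (m / ℓ) (hm' hℓ)).y ∈ S :=
    fun ℓ hℓ ↦ ⟨1, Or.inr ⟨ℓ, hℓ, (one_smul _ _).symm⟩⟩
  -- the receptacle clause on the generators, from `hGZ`
  have hrecS : ∀ s ∈ S, n' • pointsMap (W.baseChange K) (v.adicCompletion K) (j m s) ∈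
      E0Receptacle (W.baseChange K) v := by
    rintro s ⟨γ, h | ⟨ℓ, hℓ, h⟩⟩
    · rw [h, (hdict m hm).1, hsmul]
      exact (hGZ m hm γ γ.2 v hgood).1
    · rw [h, (hdict m hm).1, hsmul]
      exact (hGZ m hm γ γ.2 v hgood).2 ℓ hℓ (hle hℓ)
  -- `Tr_ℓ y(m) = a_ℓ · y(m/ℓ)↑` with `p^M ∣ a_ℓ` ((β2) + (3.3), x11b3-p4's route, witness kept)
  have htr : ∀ ℓ ∈ m.primeFactors,
      grAct ((W.baseChange (ringClassField K ι m)).toAffine.Point) (traceElt (σ m ℓ) ℓ) (y m) ∈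
        (AddSubgroup.closure S).map (zsmulAddGroupHom ((p ^ M : ℕ) : ℤ) :
          (W.baseChange (ringClassField K ι m)).toAffine.Point →+ _) := by
    intro ℓ hℓ
    obtain ⟨hℓp, hℓm, -⟩ := Nat.mem_primeFactors.mp hℓ
    obtain ⟨hℓK, hℓM⟩ := hkol ℓ (Nat.primeFactors_mono hm hn0 hℓ)
    have hℓm' : ¬ ℓ ∣ m / ℓ :=
      KolyvaginH44.not_dvd_div_of_squarefree_of_prime (hn.squarefree_of_dvd hm) hℓp hℓm
    have hNm : Nat.Coprime N m := KolyvaginH37Bridge.coprime_of_forall_not_dvd hm0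
      fun q hq ↦ (hkol q (Nat.primeFactors_mono hm hn0 hq)).1.2.1
    haveI : Fact ℓ.Prime := ⟨hℓp⟩
    -- (β2): Gross Prop. 3.7 (1) for the tree's data, `a_ℓ = W.frobeniusTrace ℓ` currency
    have hgoodℓ : W.HasGoodReductionAtPrime ℓ :=
      KolyvaginH37Bridge.hasGoodReductionAtPrime_of_modularParametrizationData Dt hℓK.2.1
    have hrelE := HeegnerTrace.frobeniusTrace_smul_eq_of_lFunction_smul_eq hgoodℓ
      (HeegnerTrace.sum_pow_pointGalHom_y_eq_lFunction_smul_map hK ι hND hℓ hℓK.2.2.2.2.1 hℓK.2.1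
        hℓm' hNm (Or.inr hD) (d m hm) (d (m / ℓ) (hm' hℓ)) (hle hℓ))
    -- in `A₀ m = E(K[m])` with the `𝒢_m`-action: `Tr_ℓ y(m) = a_ℓ • y(m/ℓ)↑`
    have hrel : grAct ((W.baseChange (ringClassField K ι m)).toAffine.Point)
        (traceElt (σ m ℓ) ℓ) (y m) = W.frobeniusTrace ℓ •
          WeierstrassCurve.Affine.Point.map (W' := W)
            ((RingClassField.inclusion ι (hle hℓ)).restrictScalars ℚ) (d (m / ℓ) (hm' hℓ)).y := by
      rw [grAct_traceElt, ← hrelE, (hdict m hm).2.1]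
      refine Finset.sum_congr rfl fun i _ ↦ ?_
      rw [hsmul, Subgroup.coe_pow, (hdict m hm).2.2.1 ℓ hℓ]
    -- (3.3): `p^M ∣ a_ℓ`
    have haℓ : ((p ^ M : ℕ) : ℤ) ∣ W.frobeniusTrace ℓ := by
      have h := ((Zhang2014.le_kolyvaginIndex_iff (W := W) (p := p) (M := M) (ℓ := ℓ)).mp hℓM).2
      exact_mod_cast h
    obtain ⟨k, hk⟩ := haℓ
    refine AddSubgroup.mem_map.mpr ⟨k • WeierstrassCurve.Affine.Point.map (W' := W)
        ((RingClassField.inclusion ι (hle hℓ)).restrictScalars ℚ) (d (m / ℓ) (hm' hℓ)).y,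
      AddSubgroup.zsmul_mem _ (AddSubgroup.subset_closure (hzS ℓ hℓ)) k, ?_⟩
    rw [zsmulAddGroupHom_apply, smul_smul, ← hk, hrel]
  -- the abstract bounded-defect END at the bad place `v` (no coprimality)
  exact zsmul_kolyvaginClass_kolyvaginPoint_mem_selmerLocalKer_of_GZ31_E0 (W.baseChange K) (hfsec m)
    hgen (hord m) hdvd (π m) (j m) (hj' m) hA' hPt' v h𝔐 hI'
    (E' := AddSubgroup.closure S) (n' := n')
    ⟨fun γ e he ↦ smul_mem_closure_of_forall_smul_mem hSstab γ he,
      AddSubgroup.subset_closure hyS, htr,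
      fun x hx ↦ zsmul_map_mem_of_mem_closure
        ((pointsMap (W.baseChange K) (v.adicCompletion K)).comp (j m))
        (E0Receptacle (W.baseChange K) v) n' hrecS hx⟩

end Concrete

end Summit.BirchSwinnertonDyer.BirchSwinnertonDyer.Theorems.KolyvaginRankRigidity

end
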